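import Summits.CriticalPhenomena.SAWScalingLimit.Theorems.SAWTotalPositivityBoundaryTP2Strip3Facing
import Summits.CriticalPhenomena.SAWScalingLimit.Theorems.SAWTotalPositivityBoundaryTP2Strip3OddOscillation
import HarnessLib

/-!
# Crux `BoundaryTP2` (stmt-CriticalPhenomena-7115), line `Sketch`: the SHARP corner inequality on 3-row strips

Lead c6.  On the strip `S_L = rectDomain L 2 = {0..L} × {0,1,2}` the corner/facing inequality
`Z((0,0),(L,2)) ≤ Z((0,0),(L,0))` — "the far corner on the same side outweighs the opposite corner", the
`(0,2|0,2)` case of the facing family and the diagonal-versus-side TP₂ inequality of the four corners —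
holds for EVERY `L` at EVERY fugacity `0 ≤ x ≤ 1/2` (`strip3_diag_le_side`).  The range is sharp: the
difference `D_L` is the first coordinate of the odd sector `(D,R)` of the transfer recursion,
`D' = x(1-x²)D - x⁴R`, `R' = x²D + x³R`, whose eigenvalues `x(1 ± √(1-4x²))/2` turn complex exactly at
`x = 1/2` (so for `x > 1/2` the sign of `D_L` oscillates) — the all-`L` threshold `x₀(L) ↓ 1/2` observed
numerically by lead c5 on these strips.  Proof: the real bridge of `strip3_kernel_ineqs` restricted to the
start row `0`, and the invariant cone `0 ≤ R ≤ 2D` of `stub_strip3_oddCone`.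
-/

noncomputable section

namespace Summit.CriticalPhenomena.SAWScalingLimit.Theorems.BoundaryTP2

open Literature.Probability.LatticeModels Literature.Probability.RandomPlanarGeometry
open Summit.CriticalPhenomena.SAWScalingLimit.Theorems.EdgeOfPositivity.Negative
open scoped ENNReal

open Classical in
/-- **Sharp corner inequality on every 3-row strip.** For every `L` and every `0 ≤ x ≤ 1/2`,
`Z_{S_L}((0,0),(L,2)) ≤ Z_{S_L}((0,0),(L,0))` for the self-avoiding path kernel of
`S_L = rectDomain L 2`. [folklore] -/
theorem strip3_diag_le_side (L : ℕ) {x : ℝ} (hx0 : 0 ≤ x) (hx : x ≤ 1 / 2) :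
    pathKernel (discreteDomainGraph (rectDomain L 2) 1) x (st 0 0) (st L 2) ≤
      pathKernel (discreteDomainGraph (rectDomain L 2) 1) x (st 0 0) (st L 0) := by
  -- the real sequences from the corner `(0,0)`
  set K : ℤ → ℕ → ℝ := fun s n =>
    (pathKernel (discreteDomainGraph (rectDomain n 2) 1) x (st 0 0) (st n s)).toReal with hK
  set PP : ℤ → ℕ → ℝ := fun s n =>
    (∑' (γ : (discreteDomainGraph (rectDomain n 2) 1).Path (st 0 0) (st n s))
        (γ' : (discreteDomainGraph (rectDomain n 2) 1).Path (st n 1) (st n (2 - s))),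
      (if List.Disjoint γ.1.support γ'.1.support then
        ENNReal.ofReal (x ^ γ.1.length) * ENNReal.ofReal (x ^ γ'.1.length) else 0)).toReal with hPP
  have h0 : (0 : ℤ) ≤ 0 ∧ (0 : ℤ) ≤ 2 := ⟨le_rfl, by norm_num⟩
  have h2 : (0 : ℤ) ≤ 2 ∧ (2 : ℤ) ≤ 2 := ⟨by norm_num, le_rfl⟩
  have recC : ∀ s : ℤ, (s = 0 ∨ s = 2) → ∀ n : ℕ,
      K s (n + 1) = x * K s n + x ^ 2 * K 1 n + x ^ 3 * K (2 - s) n + x ^ 4 * PP (2 - s) n := by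
    intro s hs n
    have h := stub_strip3_recCorner n hx0 0 h0 s hs (stub_strip3_interlaced n 0 h0 s hs)
    have h2s : (2 : ℤ) - (2 - s) = s := by ring
    simp only [hK, hPP]
    rw [h2s]
    exact strip3_toReal4 hx0 (strip3_ne_top _ _ _ _) (strip3_ne_top _ _ _ _) (strip3_ne_top _ _ _ _)
      (strip3_pair_ne_top _ _ _ _ _ _) h
  have recP : ∀ s : ℤ, (s = 0 ∨ s = 2) → ∀ n : ℕ, PP s (n + 1) = x ^ 2 * K s n + x ^ 3 * PP s n := by
    intro s hs n
    simp only [hK, hPP]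
    exact strip3_toReal2 hx0 (strip3_ne_top _ _ _ _) (strip3_pair_ne_top _ _ _ _ _ _)
      (stub_strip3_recPair n hx0 0 h0 s hs)
  have baseK : ∀ s : ℤ, 0 ≤ s ∧ s ≤ 2 → K s 0 = x ^ (0 - s).natAbs := by
    intro s hs
    simp only [hK, Nat.cast_zero]
    rw [(stub_strip3_base hx0 0 h0).1 s hs, ENNReal.toReal_ofReal (pow_nonneg hx0 _)]
  have baseP : ∀ s : ℤ, (s = 0 ∨ s = 2) → PP s 0 = if (0 : ℤ) = s then x else 0 := by
    intro s hs
    have h := congrArg ENNReal.toReal ((stub_strip3_base hx0 0 h0).2 s hs)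
    refine h.trans ?_
    split_ifs
    · exact ENNReal.toReal_ofReal hx0
    · exact ENNReal.toReal_zero
  have s0 : (0 : ℤ) = 0 ∨ (0 : ℤ) = 2 := Or.inl rfl
  have s2 : (2 : ℤ) = 0 ∨ (2 : ℤ) = 2 := Or.inr rfl
  set D : ℕ → ℝ := fun n => K 0 n - K 2 n with hDdef
  set Rq : ℕ → ℝ := fun n => PP 0 n - PP 2 n with hRdef
  have c00 := recC 0 s0
  have c02 := recC 2 s2
  have p00 := recP 0 s0
  have p02 := recP 2 s2
  norm_num at c00 c02 p00 p02
  have hD : ∀ n, D (n + 1) = x * (1 - x ^ 2) * D n - x ^ 4 * Rq n := by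
    intro n; simp only [hDdef, hRdef]; rw [c00 n, c02 n]; ring
  have hR : ∀ n, Rq (n + 1) = x ^ 2 * D n + x ^ 3 * Rq n := by
    intro n; simp only [hDdef, hRdef]; rw [p00 n, p02 n]; ring
  have k00 := baseK 0 h0
  have k02 := baseK 2 h2
  have q00 := baseP 0 s0
  have q02 := baseP 2 s2
  norm_num at k00 k02 q00 q02
  have hD0 : D 0 = 1 - x ^ 2 := by simp only [hDdef]; rw [k00, k02]
  have hR0 : Rq 0 = x := by simp only [hRdef]; rw [q00, q02]; ring
  obtain ⟨hDL, -, -⟩ := stub_strip3_oddCone hx0 hx D Rq hD0 hR0 hD hR L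
  have eD : D L = K 0 L - K 2 L := rfl
  rw [eD] at hDL
  have hle : K 2 L ≤ K 0 L := by linarith
  simp only [hK] at hle
  exact (ENNReal.toReal_le_toReal (strip3_ne_top _ _ _ _) (strip3_ne_top _ _ _ _)).1 hle


/-! ## Sharpness: for `1/2 < x < 1` the corner inequality fails on some strip (appended, lead c6) -/

open Classical in
/-- The odd sector of the 3-row strip transfer as real sequences: there are `D, R : ℕ → ℝ` obeying
`D' = x(1-x²)D - x⁴R`, `R' = x²D + x³R` from `(1-x², x)` with `D_L = Z((0,0),(L,0)) - Z((0,0),(L,2))`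
(real parts of the finite kernels), for every `x ≥ 0`. [folklore] -/
theorem strip3_oddSector_exists {x : ℝ} (hx0 : 0 ≤ x) :
    ∃ D R : ℕ → ℝ, D 0 = 1 - x ^ 2 ∧ R 0 = x ∧
      (∀ L, D (L + 1) = x * (1 - x ^ 2) * D L - x ^ 4 * R L) ∧
      (∀ L, R (L + 1) = x ^ 2 * D L + x ^ 3 * R L) ∧
      ∀ L : ℕ, D L = (pathKernel (discreteDomainGraph (rectDomain L 2) 1) x (st 0 0) (st L 0)).toReal -
        (pathKernel (discreteDomainGraph (rectDomain L 2) 1) x (st 0 0) (st L 2)).toReal := by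
  set K : ℤ → ℕ → ℝ := fun s n =>
    (pathKernel (discreteDomainGraph (rectDomain n 2) 1) x (st 0 0) (st n s)).toReal with hK
  set PP : ℤ → ℕ → ℝ := fun s n =>
    (∑' (γ : (discreteDomainGraph (rectDomain n 2) 1).Path (st 0 0) (st n s))
        (γ' : (discreteDomainGraph (rectDomain n 2) 1).Path (st n 1) (st n (2 - s))),
      (if List.Disjoint γ.1.support γ'.1.support then
        ENNReal.ofReal (x ^ γ.1.length) * ENNReal.ofReal (x ^ γ'.1.length) else 0)).toReal with hPP
  have h0 : (0 : ℤ) ≤ 0 ∧ (0 : ℤ) ≤ 2 := ⟨le_rfl, by norm_num⟩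
  have h2 : (0 : ℤ) ≤ 2 ∧ (2 : ℤ) ≤ 2 := ⟨by norm_num, le_rfl⟩
  have recC : ∀ s : ℤ, (s = 0 ∨ s = 2) → ∀ n : ℕ,
      K s (n + 1) = x * K s n + x ^ 2 * K 1 n + x ^ 3 * K (2 - s) n + x ^ 4 * PP (2 - s) n := by
    intro s hs n
    have h := stub_strip3_recCorner n hx0 0 h0 s hs (stub_strip3_interlaced n 0 h0 s hs)
    have h2s : (2 : ℤ) - (2 - s) = s := by ring
    simp only [hK, hPP]
    rw [h2s]
    exact strip3_toReal4 hx0 (strip3_ne_top _ _ _ _) (strip3_ne_top _ _ _ _) (strip3_ne_top _ _ _ _)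
      (strip3_pair_ne_top _ _ _ _ _ _) h
  have recP : ∀ s : ℤ, (s = 0 ∨ s = 2) → ∀ n : ℕ, PP s (n + 1) = x ^ 2 * K s n + x ^ 3 * PP s n := by
    intro s hs n
    simp only [hK, hPP]
    exact strip3_toReal2 hx0 (strip3_ne_top _ _ _ _) (strip3_pair_ne_top _ _ _ _ _ _)
      (stub_strip3_recPair n hx0 0 h0 s hs)
  have baseK : ∀ s : ℤ, 0 ≤ s ∧ s ≤ 2 → K s 0 = x ^ (0 - s).natAbs := by
    intro s hs
    simp only [hK, Nat.cast_zero]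
    rw [(stub_strip3_base hx0 0 h0).1 s hs, ENNReal.toReal_ofReal (pow_nonneg hx0 _)]
  have baseP : ∀ s : ℤ, (s = 0 ∨ s = 2) → PP s 0 = if (0 : ℤ) = s then x else 0 := by
    intro s hs
    have h := congrArg ENNReal.toReal ((stub_strip3_base hx0 0 h0).2 s hs)
    refine h.trans ?_
    split_ifs
    · exact ENNReal.toReal_ofReal hx0
    · exact ENNReal.toReal_zero
  have s0 : (0 : ℤ) = 0 ∨ (0 : ℤ) = 2 := Or.inl rfl
  have s2 : (2 : ℤ) = 0 ∨ (2 : ℤ) = 2 := Or.inr rfl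
  have c00 := recC 0 s0
  have c02 := recC 2 s2
  have p00 := recP 0 s0
  have p02 := recP 2 s2
  norm_num at c00 c02 p00 p02
  have k00 := baseK 0 h0
  have k02 := baseK 2 h2
  have q00 := baseP 0 s0
  have q02 := baseP 2 s2
  norm_num at k00 k02 q00 q02
  refine ⟨fun n => K 0 n - K 2 n, fun n => PP 0 n - PP 2 n, ?_, ?_, ?_, ?_, fun n => rfl⟩
  · simp only; rw [k00, k02]
  · simp only; rw [q00, q02]; ring
  · intro n; simp only; rw [c00 n, c02 n]; ring
  · intro n; simp only; rw [p00 n, p02 n]; ring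

/-- **Sharpness of the corner threshold.** For every `1/2 < x < 1` there is a length `L` at which the
corner inequality FAILS on the 3-row strip: `Z_{S_L}((0,0),(L,0)) < Z_{S_L}((0,0),(L,2))`
(`stub_strip3_oddOscillation`: the odd sector leaves the half-plane `D ≥ 0`). [folklore] -/
theorem strip3_side_lt_diag_of_half_lt {x : ℝ} (hx : 1 / 2 < x) (hx1 : x < 1) :
    ∃ L : ℕ, pathKernel (discreteDomainGraph (rectDomain L 2) 1) x (st 0 0) (st L 0) <
      pathKernel (discreteDomainGraph (rectDomain L 2) 1) x (st 0 0) (st L 2) := by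
  have hx0 : 0 ≤ x := by linarith
  obtain ⟨D, R, hD0, hR0, hD, hR, hDK⟩ := strip3_oddSector_exists hx0
  obtain ⟨L, hL⟩ := stub_strip3_oddOscillation hx hx1 D R hD0 hR0 hD hR
  refine ⟨L, ?_⟩
  rw [hDK L] at hL
  exact (ENNReal.toReal_lt_toReal (strip3_ne_top _ _ _ _) (strip3_ne_top _ _ _ _)).1 (by linarith)

/-- **The corner inequality on 3-row strips holds for all lengths iff `x ≤ 1/2`** (`0 ≤ x < 1`):
`(∀ L, Z_{S_L}((0,0),(L,2)) ≤ Z_{S_L}((0,0),(L,0))) ↔ x ≤ 1/2` — the exact all-`L` threshold of the width-3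
strips is the collision point of the odd-sector eigenvalues `x(1 ± √(1-4x²))/2`. [folklore] -/
theorem strip3_corner_forall_iff {x : ℝ} (hx0 : 0 ≤ x) (hx1 : x < 1) :
    (∀ L : ℕ, pathKernel (discreteDomainGraph (rectDomain L 2) 1) x (st 0 0) (st L 2) ≤
        pathKernel (discreteDomainGraph (rectDomain L 2) 1) x (st 0 0) (st L 0)) ↔ x ≤ 1 / 2 := by
  constructor
  · intro h
    by_contra hlt
    push Not at hlt
    obtain ⟨L, hL⟩ := strip3_side_lt_diag_of_half_lt hlt hx1
    exact absurd (h L) (not_le.2 hL)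
  · intro hx L
    exact strip3_diag_le_side L hx0 hx

end Summit.CriticalPhenomena.SAWScalingLimit.Theorems.BoundaryTP2
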